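import Summits.BirchSwinnertonDyer.Rank1Residual.Supersingular.MazurTateHeckeDescentSeq
import Summits.BirchSwinnertonDyer.Rank1Residual.Iwasawa.LambdaInvariantZeroSetTwisted
import Literature.NumberTheory.EllipticCurves.Sprung2017.SharpFlatPAdicLFunctionProofs
import HarnessLib

/-!
# Hecke descent of the Mazur–Tate elements along the cyclotomic tower, and the MIXED-LAYER
# accounting for ONE `θ_n` at ANY good prime (ordinary, `a_p = 0`, and X8's `a_3 = ±3`)
# (cell `b2b-bsdres`, supersingular family, prover B = unit `b2b-bsdres-additive-p3`, gen 9; part 1b)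

HONEST FRAMING (run/shared/lean/b2b/bsd-rank1-residual/, verbatim in every file): the goal of the
cell is to DELETE the COMBINATION-SHAPED residual classes of the Birch–Swinnerton-Dyer formula for
ALL analytic-rank `≤ 1` elliptic curves over `ℚ` — "full BSD formula for every rank `≤ 1` curve in
class `C`" assembled STRICTLY from published theorems — so that the rank-`≤ 1` remainder becomes
exactly the CONSTRUCTION-SHAPED classes, which are TYPED (missing-input `Prop`s), NOT attempted.
This is not "finishing BSD". THEOREMS ONLY (no definition, no named fact, no `sorry`); nothing about
any particular curve is asserted; nothing is booked; X8 / X7 / X6 stay CONSTRUCTION-SHAPED.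

## What this file proves, and why

Gen 8 (`Iwasawa/LambdaInvariantZeroSet*.lean`) proved that `λ(G)` counts the zeros of `G ∈ Λ ∖ {0}`
in the open unit disc, hence the ALL-LAYER accounting `r + Σ_{n ∈ S} φ(pⁿ⁺¹) ≤ λ(G)` for the
conductors `p^{n+1+e₀}` carrying a vanishing twist — for every `G` that interpolates ALL layers
(`L_p` at ordinary / multiplicative `p`; Kobayashi–Pollack's `L_p^ε` at `a_p = 0`, colourwise).
For X8 (`p = 3`, `a_3 = ±3`) the colours mix at every layer and only the SINGLE-LAYER Mazur–Tate
form was available (gen 8 §13 (e)). This file supplies the missing piece for `θ_n` ITSELF: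

* (part 1a, `MazurTateHeckeDescentSeq.lean`) the integer sequence `c_0 = 1`, `c_1 = a_p`,
  `c_{j+2} = a_p c_{j+1} − p c_j` (the Lucas sequence of `X² − a_p X + p`; carried as HYPOTHESES
  `hc0, hc1, hrec` on a function `c : ℕ → ℤ`, no definition is introduced), with its three regimes:
  `p ∤ a_p` ⇒ `c_j ≡ a_p^j (mod p)`, never `0`; `a_p = 0` ⇒ `c_{2i} = (−p)^i`, `c_{2i+1} = 0`;
  `p = 3`, `a_3 = ±3` (X8) ⇒ `c_{j+6} = −27·c_j`, so `c_j = 0 ↔ j ≡ 5 (mod 6)`.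
* §2 **HECKE DESCENT** `eval₂_mazurTateElement_add_eq_mul`: for `ζ ∈ ℂ_p` of order EXACTLY `p^{k+1}`
  and every `j`, **`θ_{k+1+j}(ζ − 1) = c_j · θ_{k+1}(ζ − 1)`** — the Mazur–Tate element of level `n`
  evaluated at a character of LOWER layer is an explicit integer multiple of the Birch sum of that
  character. Proof: the tree's three-term relation `ω_{m+1} ∣ θ_{m+2} − a_p θ_{m+1} + Φ_{p^{m+1}}(1+T) θ_m`
  (`Sprung2017.cyclotomicOmega_dvd_threeTerm`, PROVED from the Hecke relation) evaluated at `ζ − 1`: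
  `ω_{m+1}(ζ − 1) = 0` for `m ≥ k`, and `Φ_{p^{m+1}}(ζ) = p` for `m ≥ k + 1`, `= 0` for `m = k`.
* §3 **MIXED-LAYER ACCOUNTING FOR ONE MAZUR–TATE ELEMENT** `add_sum_totient_le_lam_of_mazurTate_layers`:
  `Θ ≠ 0` an integral model of `θ_n` (`ι Θ = θ_n`), `T^r ∣ Θ`, and `S` a finite set of layers `k`
  with `k + 1 ≤ n`, each either FORCED (`c_{n−k−1} = 0`) or VANISHING (some primitive even
  `p`-power-order `χ` of conductor `p^{k+1+e₀}` has `∑ χ(a)[a/p^{k+1+e₀}]⁺_f = 0`) ⇒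
  **`r + Σ_{k ∈ S} φ(p^{k+1}) ≤ λ(Θ)`**; complex side `…_of_twistedLValue_eq_zero` (`L(E, χ, 1) = 0`
  for any entire continuation, via gen 8's transport). The single-layer theorems of gens 6/8
  (`ratTwistedSymbolSum_ne_zero_of_mazurTate[_lam_lt]`) are the case `S = {n − 1}`.

Part 2 (`MazurTateHeckeDescentX8.lean`) reads this on the classes: at `a_p = 0` the forced layers of
`θ_n` are exactly those of the other parity and eat `deg ω_n^∓`, so ONE `θ_n` gives the colourwise
count of p222506 up to layer `n`; on X8 the forced layers are `k + 1 = n − 5, n − 11, …` ("trivial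
zeros" of `θ_n` at `a_3 = ±3`) and, with gen 4's reading `λ(θ_n) = deg ω_n^± + λ(L^•)`, every X8
certificate row yields CROSS-LAYER constraints `r + Σ_{k∈S} φ(3^{k+1}) ≤ deg ω_n^± + λ•`.

References (attributions of classical statements; everything used is a theorem of the tree or of
Mathlib): B. Mazur, J. Tate, J. Teitelbaum, Invent. Math. 84 (1986) §I.4 (4.2), §I.10 (10.2)–(10.3)
[MazurTateTeitelbaum1986Invent]; B. Mazur, J. Tate, Duke Math. J. 54 (1987) §1 (compatibility of the
modular elements under change of layer); F. Sprung, ANT 11 (2017) Def. 1.7 / Example 1.8 [Sprung2017];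
R. Pollack, Duke Math. J. 118 (2003) Prop. 6.9, 6.18 [Pollack2003]; L. Washington, GTM 83, §7.1–7.2
[Washington1997]. Memo: `HOME/b2b-bsdres-additive-p3/X8-ROUTE-B.md` §14 (gen 9).
-/

set_option autoImplicit false

noncomputable section

open scoped Classical MatrixGroups ModularForm

open CongruenceSubgroup Polynomial WeierstrassCurve Literature.NumberTheory.EllipticCurves
  Literature.NumberTheory.EllipticCurves.ModularForms
  Literature.NumberTheory.EllipticCurves.Sprung2017
  Summit.BirchSwinnertonDyer.Rank1Residual.X1.MuLambda
  Summit.BirchSwinnertonDyer.Rank1Residual.Iwasawa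

namespace Summit.BirchSwinnertonDyer.Rank1Residual.Supersingular

/-! ## §2. Hecke descent: `θ_{k+1+j}(ζ − 1) = c_j · θ_{k+1}(ζ − 1)` for `ζ` of order `p^{k+1}` -/

section Descent

variable {N : ℕ} [NeZero N] {f : CuspForm (Gamma0 N) 2} {p : ℕ} [hp : Fact p.Prime]

omit [NeZero N] in
/-- `ω_m(ζ − 1) = ζ^{p^m} − 1`. [folklore] -/
theorem eval₂_map_cyclotomicOmega (m : ℕ) (ζ : ℂ_[p]) :
    ((cyclotomicOmega p m).map (Int.castRingHom ℚ)).eval₂ (algebraMap ℚ ℂ_[p]) (ζ - 1) =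
      ζ ^ p ^ m - 1 := by
  rw [eval₂_map, cyclotomicOmega, eval₂_sub, eval₂_pow, eval₂_add, eval₂_X, eval₂_one,
    sub_add_cancel]

omit [NeZero N] in
/-- `Φ_{p^m}(1 + T)` at `T = ζ − 1` is `Φ_{p^m}(ζ)`. [folklore] -/
theorem eval₂_map_cyclotomic_comp (m : ℕ) (ζ : ℂ_[p]) :
    (((cyclotomic (p ^ m) ℤ).comp (X + 1)).map (Int.castRingHom ℚ)).eval₂ (algebraMap ℚ ℂ_[p])
        (ζ - 1) = (cyclotomic (p ^ m) ℂ_[p]).eval ζ := by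
  rw [eval₂_map, eval₂_comp, eval₂_add, eval₂_X, eval₂_one, sub_add_cancel, eval₂_eq_eval_map,
    map_cyclotomic]

omit [NeZero N] in
/-- `Φ_{p^{m+1}}(ζ) = p` when `ζ^{p^m} = 1` (`Φ_{p^{m+1}}(X) = Σ_{i<p} X^{i p^m}`). [folklore] -/
theorem eval_cyclotomic_prime_pow_succ_of_pow_eq_one {m : ℕ} {ζ : ℂ_[p]} (h : ζ ^ p ^ m = 1) :
    (cyclotomic (p ^ (m + 1)) ℂ_[p]).eval ζ = p := by
  rw [cyclotomic_prime_pow_eq_geom_sum hp.out, eval_finsetSum]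
  simp only [eval_pow, eval_X, h, one_pow, Finset.sum_const, Finset.card_range, nsmul_eq_mul, mul_one]

omit [NeZero N] in
/-- `Φ_{p^{m+1}}(ζ) = 0` when `ζ` has order exactly `p^{m+1}`. [folklore] -/
theorem eval_cyclotomic_prime_pow_succ_of_isPrimitiveRoot {m : ℕ} {ζ : ℂ_[p]}
    (h : IsPrimitiveRoot ζ (p ^ (m + 1))) : (cyclotomic (p ^ (m + 1)) ℂ_[p]).eval ζ = 0 :=
  (isRoot_cyclotomic_iff.mpr h).eq_zero

/-- **The three-term relation, evaluated**: for `ζ ∈ ℂ_p` with `ζ^{p^{m+1}} = 1`,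
`θ_{m+2}(ζ − 1) = a_p·θ_{m+1}(ζ − 1) − Φ_{p^{m+1}}(ζ)·θ_m(ζ − 1)` (the tree theorem
`cyclotomicOmega_dvd_threeTerm` — Mazur–Tate–Teitelbaum (10.2), Sprung's queue relation — at a root of
`ω_{m+1}`). [cite: MazurTateTeitelbaum1986Invent, §I.10 Prop. (10.2)] [cite: Sprung2017, Def. 1.7 and Example 1.8] -/
theorem eval₂_mazurTateElement_threeTerm (hf0 : IsNewform0 f) (hQ : coeffField f = ⊥)
    (hpN : ¬ p ∣ N) {ap : ℤ} (hap : cuspCoeff f p = ap) (m : ℕ) {ζ : ℂ_[p]}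
    (hζ : ζ ^ p ^ (m + 1) = 1) :
    (mazurTateElement f p (m + 2)).eval₂ (algebraMap ℚ ℂ_[p]) (ζ - 1) =
      (ap : ℂ_[p]) * (mazurTateElement f p (m + 1)).eval₂ (algebraMap ℚ ℂ_[p]) (ζ - 1) -
        (cyclotomic (p ^ (m + 1)) ℂ_[p]).eval ζ *
          (mazurTateElement f p m).eval₂ (algebraMap ℚ ℂ_[p]) (ζ - 1) := by
  obtain ⟨q, hq⟩ := cyclotomicOmega_dvd_threeTerm hf0 hQ hpN hap m
  have h := congr_arg (fun P : ℚ[X] ↦ P.eval₂ (algebraMap ℚ ℂ_[p]) (ζ - 1)) hq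
  simp only [eval₂_add, eval₂_sub, eval₂_mul, eval₂_C] at h
  rw [eval₂_map_cyclotomicOmega, eval₂_map_cyclotomic_comp, hζ, sub_self, zero_mul, map_intCast] at h
  linear_combination h

/-- **HECKE DESCENT OF THE MAZUR–TATE ELEMENTS.** `f ∈ S₂(Γ₀(N))` a rational newform, `p ∤ N`,
`a_p(f) = a_p`; `c` the Hecke descent sequence (`c_0 = 1`, `c_1 = a_p`, `c_{j+2} = a_p c_{j+1} − p c_j`);
`ζ ∈ ℂ_p` a PRIMITIVE `p^{k+1}`-th root of unity. Then for every `j`,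
**`θ_{k+1+j}(ζ − 1) = c_j · θ_{k+1}(ζ − 1)`**: the value of the level-`(k+1+j)` Mazur–Tate element
at a character of layer `k + 1` (order `p^{k+1}`, conductor `p^{k+1+e₀}`) is `c_j` times the Birch
sum of that character (`eval₂_mazurTateElement_eq_ratTwistedSymbolSum`). Proof: `§2`'s evaluated
three-term relation with `Φ_{p^{k+1}}(ζ) = 0` (first step) and `Φ_{p^{m+1}}(ζ) = p` (`m ≥ k + 1`).
(Mazur–Tate–Teitelbaum §I.10 (10.3): `θ` is compatible with the projections up to the Euler-type
factors; Mazur–Tate 1987 §1.) [cite: MazurTateTeitelbaum1986Invent, §I.10 Prop. (10.2)] -/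
theorem eval₂_mazurTateElement_add_eq_mul (hf0 : IsNewform0 f) (hQ : coeffField f = ⊥)
    (hpN : ¬ p ∣ N) {ap : ℤ} (hap : cuspCoeff f p = ap) {k : ℕ} {ζ : ℂ_[p]}
    (hζ : IsPrimitiveRoot ζ (p ^ (k + 1))) {c : ℕ → ℤ} (hc0 : c 0 = 1) (hc1 : c 1 = ap)
    (hrec : ∀ j, c (j + 2) = ap * c (j + 1) - p * c j) (j : ℕ) :
    (mazurTateElement f p (k + 1 + j)).eval₂ (algebraMap ℚ ℂ_[p]) (ζ - 1) =
      (c j : ℂ_[p]) * (mazurTateElement f p (k + 1)).eval₂ (algebraMap ℚ ℂ_[p]) (ζ - 1) := by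
  set t : ℕ → ℂ_[p] := fun m ↦ (mazurTateElement f p m).eval₂ (algebraMap ℚ ℂ_[p]) (ζ - 1) with ht
  -- powers of `ζ`
  have hpow : ∀ i, ζ ^ p ^ (k + 1 + i) = 1 := fun i ↦ by
    rw [pow_add, pow_mul, hζ.pow_eq_one, one_pow]
  -- first step: `θ_{k+2} = a_p θ_{k+1}` (`Φ_{p^{k+1}}(ζ) = 0`)
  have h1 : t (k + 2) = (ap : ℂ_[p]) * t (k + 1) := by
    have h := eval₂_mazurTateElement_threeTerm hf0 hQ hpN hap k hζ.pow_eq_one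
    rw [eval_cyclotomic_prime_pow_succ_of_isPrimitiveRoot hζ, zero_mul, sub_zero] at h
    exact h
  -- later steps: `θ_{m+2} = a_p θ_{m+1} − p θ_m` for `m ≥ k + 1`
  have h2 : ∀ i, t (k + 1 + i + 2) = (ap : ℂ_[p]) * t (k + 1 + i + 1) - (p : ℂ_[p]) * t (k + 1 + i) := by
    intro i
    have h := eval₂_mazurTateElement_threeTerm hf0 hQ hpN hap (k + 1 + i) (hpow (i + 1))
    rw [eval_cyclotomic_prime_pow_succ_of_pow_eq_one (hpow i)] at h
    exact h
  have key : ∀ j, t (k + 1 + j) = (c j : ℂ_[p]) * t (k + 1) ∧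
      t (k + 1 + (j + 1)) = (c (j + 1) : ℂ_[p]) * t (k + 1) := by
    intro j
    induction j with
    | zero =>
      refine ⟨by rw [add_zero, hc0, Int.cast_one, one_mul], ?_⟩
      rw [zero_add, hc1, show k + 1 + 1 = k + 2 by ring]
      exact h1
    | succ j ih =>
      refine ⟨ih.2, ?_⟩
      rw [show k + 1 + (j + 1 + 1) = k + 1 + j + 2 by ring, h2 j, show k + 1 + j + 1 = k + 1 + (j + 1)
        by ring, ih.1, ih.2, hrec j]
      push_cast
      ring
  exact (key j).1

/-- **Hecke descent, level form**: for `k + 1 ≤ n` and `ζ` of order exactly `p^{k+1}`,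
`θ_n(ζ − 1) = c_{n−(k+1)} · θ_{k+1}(ζ − 1)`. [cite: MazurTateTeitelbaum1986Invent, §I.10 Prop. (10.2)] -/
theorem eval₂_mazurTateElement_eq_mul_of_le (hf0 : IsNewform0 f) (hQ : coeffField f = ⊥)
    (hpN : ¬ p ∣ N) {ap : ℤ} (hap : cuspCoeff f p = ap) {k n : ℕ} (hkn : k + 1 ≤ n) {ζ : ℂ_[p]}
    (hζ : IsPrimitiveRoot ζ (p ^ (k + 1))) {c : ℕ → ℤ} (hc0 : c 0 = 1) (hc1 : c 1 = ap)
    (hrec : ∀ j, c (j + 2) = ap * c (j + 1) - p * c j) :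
    (mazurTateElement f p n).eval₂ (algebraMap ℚ ℂ_[p]) (ζ - 1) =
      (c (n - (k + 1)) : ℂ_[p]) * (mazurTateElement f p (k + 1)).eval₂ (algebraMap ℚ ℂ_[p]) (ζ - 1) := by
  obtain ⟨j, rfl⟩ : ∃ j, n = k + 1 + j := ⟨n - (k + 1), by omega⟩
  rw [Nat.add_sub_cancel_left]
  exact eval₂_mazurTateElement_add_eq_mul hf0 hQ hpN hap hζ hc0 hc1 hrec j

/-- **Hecke descent in terms of Birch sums**: for a PRIMITIVE even `p`-power-order character `χ` of
conductor `p^{k+1+e₀}` with values in `ℂ_p` (a character of `Γ` of order `p^{k+1}`, so `ζ = χ(γ)` is a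
primitive `p^{k+1}`-th root of unity) and `k + 1 ≤ n`:
`θ_n(χ(γ) − 1) = c_{n−k−1} · ∑_a χ(a)[a/p^{k+1+e₀}]⁺_f`. [cite: MazurTateTeitelbaum1986Invent, §I.10 Prop. (10.2) and §I.13] -/
theorem eval₂_mazurTateElement_eq_mul_ratTwistedSymbolSum (hf0 : IsNewform0 f)
    (hQ : coeffField f = ⊥) (hpN : ¬ p ∣ N) {ap : ℤ} (hap : cuspCoeff f p = ap) {k n : ℕ}
    (hkn : k + 1 ≤ n) (χ : DirichletCharacter ℂ_[p] (p ^ (k + 1 + cyclotomicExponent p)))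
    (hχ : χ.IsPrimitive) (hev : χ.Even) (hord : ∃ j : ℕ, orderOf χ = p ^ j) {c : ℕ → ℤ}
    (hc0 : c 0 = 1) (hc1 : c 1 = ap) (hrec : ∀ j, c (j + 2) = ap * c (j + 1) - p * c j) :
    (mazurTateElement f p n).eval₂ (algebraMap ℚ ℂ_[p])
        (χ (cyclotomicGenerator p : ZMod (p ^ (k + 1 + cyclotomicExponent p))) - 1) =
      (c (n - (k + 1)) : ℂ_[p]) * ratTwistedSymbolSum f χ := by
  rw [eval₂_mazurTateElement_eq_mul_of_le hf0 hQ hpN hap hkn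
    (isPrimitiveRoot_apply_cyclotomicGenerator χ hχ hev hord) hc0 hc1 hrec,
    eval₂_mazurTateElement_eq_ratTwistedSymbolSum f χ hev hord]

end Descent

/-! ## §3. Mixed-layer accounting for ONE Mazur–Tate element -/

section Accounting

variable {N : ℕ} [NeZero N] {f : CuspForm (Gamma0 N) 2} {p : ℕ} [hp : Fact p.Prime]

omit [NeZero N] in
/-- **An integral model of `θ_n` evaluates, at any `z ∈ ℂ_p`, to `θ_n(z)`** (finite sum).
[cite: Pollack2003, Def. 6.15] -/
theorem hasSum_mazurTate_eq_eval₂ {n : ℕ} {Θ : IwasawaAlgebra p}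
    (hΘ : iwasawaToPowerSeries p Θ =
      ((mazurTateElement f p n).map (algebraMap ℚ ℚ_[p]) : PowerSeries ℚ_[p])) (z : ℂ_[p]) :
    HasSum (fun i ↦ ((algebraMap ℚ_[p] ℂ_[p]).comp (algebraMap ℤ_[p] ℚ_[p]))
        (PowerSeries.coeff i Θ) * z ^ i) ((mazurTateElement f p n).eval₂ (algebraMap ℚ ℂ_[p]) z) := by
  have h := hasSum_map_coeff_coe_mul_pow (algebraMap ℚ ℂ_[p]) (mazurTateElement f p n) z
  refine h.congr_fun fun i ↦ ?_
  have hi : algebraMap ℤ_[p] ℚ_[p] (PowerSeries.coeff i Θ) =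
      algebraMap ℚ ℚ_[p] ((mazurTateElement f p n).coeff i) := by
    have h1 := congr_arg (PowerSeries.coeff i) hΘ
    rw [iwasawaToPowerSeries, PowerSeries.coeff_map, Polynomial.coeff_coe, Polynomial.coeff_map] at h1
    exact h1
  show ((algebraMap ℚ_[p] ℂ_[p]).comp (algebraMap ℤ_[p] ℚ_[p])) (PowerSeries.coeff i Θ) * z ^ i =
    algebraMap ℚ ℂ_[p] (PowerSeries.coeff i (mazurTateElement f p n : PowerSeries ℚ)) * z ^ i
  rw [Polynomial.coeff_coe, RingHom.comp_apply, hi]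
  congr 1
  simp only [eq_ratCast, map_ratCast]

omit [NeZero N] in
/-- There is a primitive `p^{k+1}`-th root of unity in `ℂ_p` (algebraically closed of characteristic
zero). [folklore] -/
theorem exists_isPrimitiveRoot_padicComplex (k : ℕ) : ∃ ζ : ℂ_[p], IsPrimitiveRoot ζ (p ^ (k + 1)) := by
  have hpos : 0 < p ^ (k + 1) := pow_pos hp.out.pos _
  have hdeg : (cyclotomic (p ^ (k + 1)) ℂ_[p]).degree ≠ 0 := by
    rw [degree_cyclotomic, Ne, Nat.cast_eq_zero]
    exact (Nat.totient_pos.mpr hpos).ne'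
  obtain ⟨ζ, hζ⟩ := IsAlgClosed.exists_root (cyclotomic (p ^ (k + 1)) ℂ_[p]) hdeg
  exact ⟨ζ, isRoot_cyclotomic_iff.mp hζ⟩

/-- **A FORCED zero**: if `c_{n−k−1} = 0` then every integral model of `θ_n` vanishes at `ζ − 1` for
every `ζ` of order exactly `p^{k+1}` (`k + 1 ≤ n`). [cite: MazurTateTeitelbaum1986Invent, §I.10 Prop. (10.2)] -/
theorem hasSum_mazurTate_zero_of_heckeDescentSeq_eq_zero (hf0 : IsNewform0 f) (hQ : coeffField f = ⊥)
    (hpN : ¬ p ∣ N) {ap : ℤ} (hap : cuspCoeff f p = ap) {k n : ℕ} (hkn : k + 1 ≤ n)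
    {Θ : IwasawaAlgebra p}
    (hΘ : iwasawaToPowerSeries p Θ =
      ((mazurTateElement f p n).map (algebraMap ℚ ℚ_[p]) : PowerSeries ℚ_[p]))
    {ζ : ℂ_[p]} (hζ : IsPrimitiveRoot ζ (p ^ (k + 1))) {c : ℕ → ℤ} (hc0 : c 0 = 1) (hc1 : c 1 = ap)
    (hrec : ∀ j, c (j + 2) = ap * c (j + 1) - p * c j) (hc : c (n - (k + 1)) = 0) :
    HasSum (fun i ↦ ((algebraMap ℚ_[p] ℂ_[p]).comp (algebraMap ℤ_[p] ℚ_[p]))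
        (PowerSeries.coeff i Θ) * (ζ - 1) ^ i) 0 := by
  have h := hasSum_mazurTate_eq_eval₂ hΘ (ζ - 1)
  rwa [eval₂_mazurTateElement_eq_mul_of_le hf0 hQ hpN hap hkn hζ hc0 hc1 hrec, hc, Int.cast_zero,
    zero_mul] at h

/-- **A VANISHING lower layer is a zero of `θ_n`**: if some primitive even `p`-power-order `χ` of
conductor `p^{k+1+e₀}` (`k + 1 ≤ n`) has `∑ χ(a)[a/p^{k+1+e₀}]⁺_f = 0`, then every integral model of
`θ_n` vanishes at `χ(γ) − 1`, a point of order-`p^{k+1}` type. [cite: MazurTateTeitelbaum1986Invent, §I.10 Prop. (10.2) and §I.13] -/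
theorem hasSum_mazurTate_zero_of_ratTwistedSymbolSum_eq_zero (hf0 : IsNewform0 f)
    (hQ : coeffField f = ⊥) (hpN : ¬ p ∣ N) {ap : ℤ} (hap : cuspCoeff f p = ap) {k n : ℕ}
    (hkn : k + 1 ≤ n) {Θ : IwasawaAlgebra p}
    (hΘ : iwasawaToPowerSeries p Θ =
      ((mazurTateElement f p n).map (algebraMap ℚ ℚ_[p]) : PowerSeries ℚ_[p]))
    (χ : DirichletCharacter ℂ_[p] (p ^ (k + 1 + cyclotomicExponent p))) (hχ : χ.IsPrimitive)
    (hev : χ.Even) (hord : ∃ j : ℕ, orderOf χ = p ^ j) {c : ℕ → ℤ} (hc0 : c 0 = 1) (hc1 : c 1 = ap)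
    (hrec : ∀ j, c (j + 2) = ap * c (j + 1) - p * c j) (h0 : ratTwistedSymbolSum f χ = 0) :
    HasSum (fun i ↦ ((algebraMap ℚ_[p] ℂ_[p]).comp (algebraMap ℤ_[p] ℚ_[p]))
        (PowerSeries.coeff i Θ) *
          (χ (cyclotomicGenerator p : ZMod (p ^ (k + 1 + cyclotomicExponent p))) - 1) ^ i) 0 := by
  have h := hasSum_mazurTate_eq_eval₂ hΘ
    (χ (cyclotomicGenerator p : ZMod (p ^ (k + 1 + cyclotomicExponent p))) - 1)
  rwa [eval₂_mazurTateElement_eq_mul_ratTwistedSymbolSum hf0 hQ hpN hap hkn χ hχ hev hord hc0 hc1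
    hrec, h0, mul_zero] at h

/-- **MIXED-LAYER ACCOUNTING FOR ONE MAZUR–TATE ELEMENT.** `f ∈ S₂(Γ₀(N))` a rational newform,
`p ∤ N`, `a_p(f) = a_p`, `c` the Hecke descent sequence; `Θ ≠ 0` an integral model of `θ_n`
(`ι Θ = θ_n`) with `T^r ∣ Θ`; `S` a finite set of layers `k` with `k + 1 ≤ n`, each of which is either
FORCED (`c_{n−k−1} = 0`) or VANISHING (some primitive even `p`-power-order `χ` of conductor
`p^{k+1+e₀}` has `∑_a χ(a)[a/p^{k+1+e₀}]⁺_f = 0`, i.e. `L(f, χ̄, 1) = 0`). Then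
**`r + Σ_{k ∈ S} φ(p^{k+1}) ≤ λ(Θ)`** — every such layer contributes the full Galois orbit of
`φ(p^{k+1})` zeros of `Θ` in the open unit disc, and `λ(Θ)` counts them all (gen 8,
`add_sum_totient_le_lam_of_X_pow_dvd`). No hypothesis on `μ(Θ)`. The single-layer theorems
(`ratTwistedSymbolSum_ne_zero_of_mazurTate_lam_lt`, gens 6/8) are the case `S = {n − 1}`.
[cite: MazurTateTeitelbaum1986Invent, §I.10 Prop. (10.2) and §I.13] [cite: Washington1997, §7.1–7.2 and Thm. 7.3] -/
theorem add_sum_totient_le_lam_of_mazurTate_layers (hf0 : IsNewform0 f) (hQ : coeffField f = ⊥)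
    (hpN : ¬ p ∣ N) {ap : ℤ} (hap : cuspCoeff f p = ap) {n : ℕ} {Θ : IwasawaAlgebra p}
    (hΘ : iwasawaToPowerSeries p Θ =
      ((mazurTateElement f p n).map (algebraMap ℚ ℚ_[p]) : PowerSeries ℚ_[p]))
    (hΘ0 : Θ ≠ 0) {r : ℕ} (hX : (PowerSeries.X : IwasawaAlgebra p) ^ r ∣ Θ) {c : ℕ → ℤ}
    (hc0 : c 0 = 1) (hc1 : c 1 = ap) (hrec : ∀ j, c (j + 2) = ap * c (j + 1) - p * c j)
    (S : Finset ℕ)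
    (hS : ∀ k ∈ S, k + 1 ≤ n ∧ (c (n - (k + 1)) = 0 ∨
      ∃ χ : DirichletCharacter ℂ_[p] (p ^ (k + 1 + cyclotomicExponent p)), χ.IsPrimitive ∧ χ.Even ∧
        (∃ j : ℕ, orderOf χ = p ^ j) ∧ ratTwistedSymbolSum f χ = 0)) :
    r + ∑ k ∈ S, Nat.totient (p ^ (k + 1)) ≤ lam Θ := by
  refine add_sum_totient_le_lam_of_X_pow_dvd hΘ0 hX S fun k hk ↦ ?_
  obtain ⟨hkn, hforced | ⟨χ, hχ, hev, hord, h0⟩⟩ := hS k hk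
  · obtain ⟨ζ, hζ⟩ := exists_isPrimitiveRoot_padicComplex (p := p) k
    exact ⟨ζ, hζ, hasSum_mazurTate_zero_of_heckeDescentSeq_eq_zero hf0 hQ hpN hap hkn hΘ hζ hc0 hc1
      hrec hforced⟩
  · exact ⟨_, isPrimitiveRoot_apply_cyclotomicGenerator χ hχ hev hord,
      hasSum_mazurTate_zero_of_ratTwistedSymbolSum_eq_zero hf0 hQ hpN hap hkn hΘ χ hχ hev hord hc0 hc1
        hrec h0⟩

/-- **Log form**: `r + p^{#S} ≤ λ(Θ) + 1` under the same hypotheses (the `#S` cheapest layers cost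
`p^{#S} − 1`). [cite: Washington1997, §7.1–7.2 and Thm. 7.3] -/
theorem add_pow_card_le_lam_succ_of_mazurTate_layers (hf0 : IsNewform0 f) (hQ : coeffField f = ⊥)
    (hpN : ¬ p ∣ N) {ap : ℤ} (hap : cuspCoeff f p = ap) {n : ℕ} {Θ : IwasawaAlgebra p}
    (hΘ : iwasawaToPowerSeries p Θ =
      ((mazurTateElement f p n).map (algebraMap ℚ ℚ_[p]) : PowerSeries ℚ_[p]))
    (hΘ0 : Θ ≠ 0) {r : ℕ} (hX : (PowerSeries.X : IwasawaAlgebra p) ^ r ∣ Θ) {c : ℕ → ℤ}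
    (hc0 : c 0 = 1) (hc1 : c 1 = ap) (hrec : ∀ j, c (j + 2) = ap * c (j + 1) - p * c j)
    (S : Finset ℕ)
    (hS : ∀ k ∈ S, k + 1 ≤ n ∧ (c (n - (k + 1)) = 0 ∨
      ∃ χ : DirichletCharacter ℂ_[p] (p ^ (k + 1 + cyclotomicExponent p)), χ.IsPrimitive ∧ χ.Even ∧
        (∃ j : ℕ, orderOf χ = p ^ j) ∧ ratTwistedSymbolSum f χ = 0)) :
    r + p ^ S.card ≤ lam Θ + 1 := by
  have h1 := add_sum_totient_le_lam_of_mazurTate_layers hf0 hQ hpN hap hΘ hΘ0 hX hc0 hc1 hrec S hS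
  have h2 := pow_card_le_one_add_sum_totient (p := p) S
  omega

end Accounting

/-! ## §4. Complex side, for the newform of `E` -/

section Complex

variable {W : WeierstrassCurve ℚ} [W.IsElliptic] [W.IsGloballyMinimal] {N : ℕ} [NeZero N]
  {f : CuspForm (Gamma0 N) 2} {p : ℕ} [hp : Fact p.Prime]

/-- **MIXED-LAYER ACCOUNTING, complex side.** `f` the newform of `E = W`, `p` a prime of GOOD
reduction (ordinary or supersingular), `c` the Hecke descent sequence of `(a_p(E), p)`; `Θ ≠ 0` an
integral model of `θ_n` with `T^r ∣ Θ`; `S` a finite set of layers `k`, `k + 1 ≤ n`, each FORCED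
(`c_{n−k−1} = 0`) or carrying a primitive even `p`-power-order Dirichlet character `χ` of conductor
`p^{k+1+e₀}` and an entire continuation `L_χ` of `L(E, χ, s)` with **`L_χ(1) = 0`**. Then
**`r + Σ_{k ∈ S} φ(p^{k+1}) ≤ λ(Θ)`**. [cite: MazurTateTeitelbaum1986Invent, §I.8 (8.6), §I.10 Prop. (10.2)]
[cite: Washington1997, §7.1–7.2 and Thm. 7.3] -/
theorem add_sum_totient_le_lam_of_mazurTate_layers_of_twistedLValue_eq_zero (hf : IsNewformOf W f)
    (hgood : W.HasGoodReductionAtPrime p) {n : ℕ} {Θ : IwasawaAlgebra p}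
    (hΘ : iwasawaToPowerSeries p Θ =
      ((mazurTateElement f p n).map (algebraMap ℚ ℚ_[p]) : PowerSeries ℚ_[p]))
    (hΘ0 : Θ ≠ 0) {r : ℕ} (hX : (PowerSeries.X : IwasawaAlgebra p) ^ r ∣ Θ) {c : ℕ → ℤ}
    (hc0 : c 0 = 1) (hc1 : c 1 = W.frobeniusTrace p)
    (hrec : ∀ j, c (j + 2) = W.frobeniusTrace p * c (j + 1) - p * c j) (S : Finset ℕ)
    (hS : ∀ k ∈ S, k + 1 ≤ n ∧ (c (n - (k + 1)) = 0 ∨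
      ∃ χ : DirichletCharacter ℂ (p ^ (k + 1 + cyclotomicExponent p)), χ.IsPrimitive ∧ χ.Even ∧
        (∃ j : ℕ, orderOf χ = p ^ j) ∧ ∃ Lχ : ℂ → ℂ, Differentiable ℂ Lχ ∧
          (∀ s : ℂ, 2 < s.re → Lχ s = twistedLSeries f χ s) ∧ Lχ 1 = 0)) :
    r + ∑ k ∈ S, Nat.totient (p ^ (k + 1)) ≤ lam Θ := by
  refine add_sum_totient_le_lam_of_mazurTate_layers hf.1 hf.coeffField_eq_bot
    (not_dvd_level_of_isNewformOf hf hgood) (cuspCoeff_eq_frobeniusTrace_of_isNewformOf_holds hf hgood)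
    hΘ hΘ0 hX hc0 hc1 hrec S fun k hk ↦ ?_
  obtain ⟨hkn, hforced | ⟨χ, hχ, hev, hord, Lχ, hLd, hL, h1⟩⟩ := hS k hk
  · exact ⟨hkn, Or.inl hforced⟩
  · haveI : NeZero (p ^ (k + 1 + cyclotomicExponent p)) := ⟨pow_ne_zero _ hp.out.ne_zero⟩
    exact ⟨hkn, Or.inr (exists_padic_ratTwistedSymbolSum_eq_zero_of_twistedLValue_eq_zero hf χ hχ hev
      hord hLd hL h1)⟩

/-- **Log form, complex side**: `r + p^{#S} ≤ λ(Θ) + 1`. [cite: MazurTateTeitelbaum1986Invent, §I.8 (8.6), §I.10 Prop. (10.2)]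
[cite: Washington1997, §7.1–7.2 and Thm. 7.3] -/
theorem add_pow_card_le_lam_succ_of_mazurTate_layers_of_twistedLValue_eq_zero (hf : IsNewformOf W f)
    (hgood : W.HasGoodReductionAtPrime p) {n : ℕ} {Θ : IwasawaAlgebra p}
    (hΘ : iwasawaToPowerSeries p Θ =
      ((mazurTateElement f p n).map (algebraMap ℚ ℚ_[p]) : PowerSeries ℚ_[p]))
    (hΘ0 : Θ ≠ 0) {r : ℕ} (hX : (PowerSeries.X : IwasawaAlgebra p) ^ r ∣ Θ) {c : ℕ → ℤ}
    (hc0 : c 0 = 1) (hc1 : c 1 = W.frobeniusTrace p)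
    (hrec : ∀ j, c (j + 2) = W.frobeniusTrace p * c (j + 1) - p * c j) (S : Finset ℕ)
    (hS : ∀ k ∈ S, k + 1 ≤ n ∧ (c (n - (k + 1)) = 0 ∨
      ∃ χ : DirichletCharacter ℂ (p ^ (k + 1 + cyclotomicExponent p)), χ.IsPrimitive ∧ χ.Even ∧
        (∃ j : ℕ, orderOf χ = p ^ j) ∧ ∃ Lχ : ℂ → ℂ, Differentiable ℂ Lχ ∧
          (∀ s : ℂ, 2 < s.re → Lχ s = twistedLSeries f χ s) ∧ Lχ 1 = 0)) :
    r + p ^ S.card ≤ lam Θ + 1 := by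
  have h1 := add_sum_totient_le_lam_of_mazurTate_layers_of_twistedLValue_eq_zero hf hgood hΘ hΘ0 hX
    hc0 hc1 hrec S hS
  have h2 := pow_card_le_one_add_sum_totient (p := p) S
  omega

end Complex

end Summit.BirchSwinnertonDyer.Rank1Residual.Supersingular

end
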